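import Mathlib.Combinatorics.SetFamily.FourFunctions
import Mathlib.Tactic
import HarnessLib
import HarnessLib.Audit.Tags

/-!
# `NoHeavyLowerTail` (crux stmt-CriticalPhenomena-4575), master-family line P1 (gen 28):
# the DISTINCT-PAIRS AHLSWEDE–DAYKIN INEQUALITY

Support file (seat `prim-masterthm-p1`, gen 28; `--supports stmt-CriticalPhenomena-4575`).  Four definitions (`pairSups`, `pairInfs`,
`slice₀`, `slice₁`), no `sorry`, standard axioms.  Memo `run/shared/lean/prim/prim-masterthm/FROM-prim-masterthm-p1-g28-STRONG-DAYKIN.md`.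

Daykin's inequality `|𝒜||ℬ| ≤ |𝒜 ∨ ℬ||𝒜 ∧ ℬ|` (Mathlib `Finset.le_card_infs_mul_card_sups`) and its weighted form, the four functions
theorem (Mathlib `Finset.four_functions_theorem`), count ALL pairs; for `𝒜 = ℬ` they are trivial (`𝒜 ∨ 𝒜 ⊇ 𝒜`).  The programme's 2-copy
rung (gen 26 `G_JM`, gen 27 `SignedColouredDaykin3`, gen 28 `StrongDaykin` in `…SahiStrongDaykinConjecture`) needs the DIAGONAL REMOVED.

**THEOREM (distinct-pairs Ahlswede–Daykin, `sq_sum_le_of_logSupermodular`) [this work].**  For `𝒮 ⊆ 2^u` and a nonnegative weight `w`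
log-supermodular on `2^u` (`w s · w t ≤ w (s ∩ t) · w (s ∪ t)`):
  `(Σ_{s ∈ 𝒮} w s)² ≤ Σ_{s ∈ 𝒮} (w s)² + 2 · (Σ_{pairInfs 𝒮} w) · (Σ_{pairSups 𝒮} w)`,
where `pairSups 𝒮 = {s ∪ t : s ≠ t ∈ 𝒮}`, `pairInfs 𝒮 = {s ∩ t : s ≠ t ∈ 𝒮}`; i.e. `Σ_{s ≠ t} w(s)w(t) ≤ 2·w(pairInfs)·w(pairSups)`.
Counting form (`card_choose_two_le`): **`m(m−1)/2 ≤ |pairInfs 𝒮|·|pairSups 𝒮|` for every family of `m` distinct finite sets** — tight for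
the `m` facets of a simplex (`pairSups = {top}`, `pairInfs` = the `C(m,2)` codimension-2 faces); Daykin applied to the best cut of `𝒮` into two
halves gives only `⌊m²/4⌋`.
PROOF: induction on the ground set.  Slice `𝒮` by the last point `a` into `T₀ = {s : a ∉ s}` and `T₁ = {s ∖ a : a ∈ s}`; the unions of two
distinct members that contain `a` include ALL of `T₀ ∨ T₁` (a level-0 and a level-1 member are always distinct) together with `pairSups T₁`,
those avoiding `a` are `pairSups T₀`, and dually for intersections (§3); the cross term `Σ_{T₀} w · Σ_{T₁} w(a ∪ ·) ≤ w(T₀ ∧ T₁)·w(a ∪ (T₀ ∨ T₁))`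
is the four functions theorem for `(w, w(a ∪ ·), w, w(a ∪ ·))` on `2^u`, the slices are the induction hypothesis, and
`(Σ_{T₀} + Σ_{T₁})² = Σ_{T₀}² + Σ_{T₁}² + 2·Σ_{T₀}Σ_{T₁}` is matched term by term (§4).
HONEST FRAMING: a theorem with complete proof; it is the "all classes singletons" case of the open `StrongDaykin` conjecture. [this work]
-/

namespace Summit.CriticalPhenomena.PercolationContinuityZ3.Theorems.SahiStrongDaykin

open Finset
open scoped FinsetFamily

variable {α : Type*} [DecidableEq α]

/-! ### 1. Unions and intersections of pairs of DISTINCT members -/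

/-- The unions `s ∪ t` of two DISTINCT members of `𝒮`. [this work] -/
def pairSups (𝒮 : Finset (Finset α)) : Finset (Finset α) := 𝒮.offDiag.image fun p => p.1 ∪ p.2

/-- The intersections `s ∩ t` of two DISTINCT members of `𝒮`. [this work] -/
def pairInfs (𝒮 : Finset (Finset α)) : Finset (Finset α) := 𝒮.offDiag.image fun p => p.1 ∩ p.2

/-- Membership in `pairSups`. [this work] -/
theorem union_mem_pairSups {𝒮 : Finset (Finset α)} {s t : Finset α} (hs : s ∈ 𝒮) (ht : t ∈ 𝒮) (hst : s ≠ t) :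
    s ∪ t ∈ pairSups 𝒮 :=
  mem_image.2 ⟨(s, t), mem_offDiag.2 ⟨hs, ht, hst⟩, rfl⟩

/-- Membership in `pairInfs`. [this work] -/
theorem inter_mem_pairInfs {𝒮 : Finset (Finset α)} {s t : Finset α} (hs : s ∈ 𝒮) (ht : t ∈ 𝒮) (hst : s ≠ t) :
    s ∩ t ∈ pairInfs 𝒮 :=
  mem_image.2 ⟨(s, t), mem_offDiag.2 ⟨hs, ht, hst⟩, rfl⟩

/-- `pairSups` is monotone. [this work] -/
theorem pairSups_mono {𝒮 𝒯 : Finset (Finset α)} (h : 𝒮 ⊆ 𝒯) : pairSups 𝒮 ⊆ pairSups 𝒯 :=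
  image_subset_image (offDiag_mono h)

/-- `pairInfs` is monotone. [this work] -/
theorem pairInfs_mono {𝒮 𝒯 : Finset (Finset α)} (h : 𝒮 ⊆ 𝒯) : pairInfs 𝒮 ⊆ pairInfs 𝒯 :=
  image_subset_image (offDiag_mono h)

/-- Members of `pairSups 𝒮` lie below the ground set. [this work] -/
theorem subset_of_mem_pairSups {𝒮 : Finset (Finset α)} {u x : Finset α} (h𝒮 : 𝒮 ⊆ u.powerset)
    (hx : x ∈ pairSups 𝒮) : x ⊆ u := by
  obtain ⟨p, hp, rfl⟩ := mem_image.1 hx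
  obtain ⟨h1, h2, -⟩ := mem_offDiag.1 hp
  exact union_subset (mem_powerset.1 (h𝒮 h1)) (mem_powerset.1 (h𝒮 h2))

/-- Members of `pairInfs 𝒮` lie below the ground set. [this work] -/
theorem subset_of_mem_pairInfs {𝒮 : Finset (Finset α)} {u x : Finset α} (h𝒮 : 𝒮 ⊆ u.powerset)
    (hx : x ∈ pairInfs 𝒮) : x ⊆ u := by
  obtain ⟨p, hp, rfl⟩ := mem_image.1 hx
  obtain ⟨h1, -, -⟩ := mem_offDiag.1 hp
  exact inter_subset_left.trans (mem_powerset.1 (h𝒮 h1))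

/-! ### 2. Slicing a family by one point -/

section Slices

variable (a : α) (𝒮 : Finset (Finset α))

/-- The members avoiding `a`. [this work] -/
def slice₀ : Finset (Finset α) := 𝒮.filter fun s => a ∉ s

/-- The members containing `a`, with `a` removed. [this work] -/
def slice₁ : Finset (Finset α) := (𝒮.filter fun s => a ∈ s).image fun s => s.erase a

variable {a 𝒮}

/-- Members of `slice₀` are members avoiding `a`. [this work] -/
theorem mem_slice₀ {s : Finset α} : s ∈ slice₀ a 𝒮 ↔ s ∈ 𝒮 ∧ a ∉ s := mem_filter

/-- Members of `slice₁` are `a`-free sets whose `a`-extension is a member. [this work] -/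
theorem mem_slice₁ {s : Finset α} : s ∈ slice₁ a 𝒮 ↔ insert a s ∈ 𝒮 ∧ a ∉ s := by
  constructor
  · intro h
    obtain ⟨t, ht, rfl⟩ := mem_image.1 h
    obtain ⟨ht𝒮, hat⟩ := mem_filter.1 ht
    exact ⟨by rwa [insert_erase hat], notMem_erase a t⟩
  · rintro ⟨h1, h2⟩
    exact mem_image.2 ⟨insert a s, mem_filter.2 ⟨h1, mem_insert_self a s⟩, erase_insert h2⟩

/-- An `a`-free subset of `insert a u` is a subset of `u`. [folklore] -/
private theorem subset_of_subset_insert {u s : Finset α} (has : a ∉ s) (h : s ⊆ insert a u) : s ⊆ u :=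
  fun _ hx => (mem_insert.1 (h hx)).resolve_left fun hxa => has (hxa ▸ hx)

/-- With ground set `insert a u`, `a ∉ u`: `slice₀ ⊆ 2^u`. [this work] -/
theorem slice₀_subset {u : Finset α} (h𝒮 : 𝒮 ⊆ (insert a u).powerset) :
    slice₀ a 𝒮 ⊆ u.powerset := fun _ hs =>
  mem_powerset.2 (subset_of_subset_insert (mem_slice₀.1 hs).2 (mem_powerset.1 (h𝒮 (mem_slice₀.1 hs).1)))

/-- With ground set `insert a u`: `slice₁ ⊆ 2^u`. [this work] -/
theorem slice₁_subset {u : Finset α} (h𝒮 : 𝒮 ⊆ (insert a u).powerset) :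
    slice₁ a 𝒮 ⊆ u.powerset := fun s hs =>
  mem_powerset.2 (subset_of_subset_insert (mem_slice₁.1 hs).2
    ((subset_insert a s).trans (mem_powerset.1 (h𝒮 (mem_slice₁.1 hs).1))))

/-- Splitting a sum over `𝒮` along the two slices. [this work] -/
theorem sum_eq_sum_slice₀_add_sum_slice₁ (f : Finset α → ℝ) :
    ∑ s ∈ 𝒮, f s = ∑ s ∈ slice₀ a 𝒮, f s + ∑ s ∈ slice₁ a 𝒮, f (insert a s) := by
  have h1 : ∑ s ∈ slice₁ a 𝒮, f (insert a s) = ∑ s ∈ 𝒮.filter (fun s => a ∈ s), f s := by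
    unfold slice₁
    rw [sum_image]
    · refine sum_congr rfl fun s hs => ?_
      rw [insert_erase (mem_filter.1 hs).2]
    · intro s hs t ht hst
      exact erase_injOn' a (mem_filter.1 hs).2 (mem_filter.1 ht).2 hst
  rw [h1, slice₀, add_comm]
  exact (sum_filter_add_sum_filter_not 𝒮 (fun s => a ∈ s) f).symm

end Slices

/-! ### 3. What the slices see of the distinct-pair unions and intersections -/

section Lifts

variable {a : α} {u : Finset α} {𝒮 : Finset (Finset α)}

/-- Unions containing `a`: ALL of `slice₀ ∨ slice₁` and `pairSups slice₁` lift (with `a` added) into `pairSups 𝒮` —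
a level-0 and a level-1 member are automatically distinct. [this work] -/
theorem image_insert_subset_pairSups :
    ((slice₀ a 𝒮 ⊻ slice₁ a 𝒮) ∪ pairSups (slice₁ a 𝒮)).image (insert a) ⊆ pairSups 𝒮 := by
  intro x hx
  obtain ⟨y, hy, rfl⟩ := mem_image.1 hx
  rcases mem_union.1 hy with hy | hy
  · obtain ⟨s, hs, t, ht, rfl⟩ := mem_sups.1 hy
    obtain ⟨hs𝒮, has⟩ := mem_slice₀.1 hs
    obtain ⟨ht𝒮, hat⟩ := mem_slice₁.1 ht
    have hne : s ≠ insert a t := fun h => has (h ▸ mem_insert_self a t)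
    have : insert a (s ⊔ t) = s ∪ insert a t := by
      ext x; simp only [sup_eq_union, mem_union, mem_insert]; tauto
    rw [this]
    exact union_mem_pairSups hs𝒮 ht𝒮 hne
  · obtain ⟨p, hp, rfl⟩ := mem_image.1 hy
    obtain ⟨h1, h2, h3⟩ := mem_offDiag.1 hp
    obtain ⟨h1𝒮, ha1⟩ := mem_slice₁.1 h1
    obtain ⟨h2𝒮, ha2⟩ := mem_slice₁.1 h2
    have hne : insert a p.1 ≠ insert a p.2 := fun h => h3 (by
      have := congrArg (fun s => s.erase a) h
      simpa only [erase_insert ha1, erase_insert ha2] using this)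
    rw [show insert a (p.1 ∪ p.2) = insert a p.1 ∪ insert a p.2 from insert_union_distrib a p.1 p.2]
    exact union_mem_pairSups h1𝒮 h2𝒮 hne

/-- Intersections avoiding `a`: ALL of `slice₀ ∧ slice₁` lies in `pairInfs 𝒮`. [this work] -/
theorem infs_slice_subset_pairInfs : slice₀ a 𝒮 ⊼ slice₁ a 𝒮 ⊆ pairInfs 𝒮 := by
  intro x hx
  obtain ⟨s, hs, t, ht, rfl⟩ := mem_infs.1 hx
  obtain ⟨hs𝒮, has⟩ := mem_slice₀.1 hs
  obtain ⟨ht𝒮, hat⟩ := mem_slice₁.1 ht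
  have hne : s ≠ insert a t := fun h => has (h ▸ mem_insert_self a t)
  have : s ⊓ t = s ∩ insert a t := by
    rw [inf_eq_inter]
    ext x; simp only [mem_inter, mem_insert]
    constructor
    · rintro ⟨h1, h2⟩; exact ⟨h1, Or.inr h2⟩
    · rintro ⟨h1, h2⟩
      rcases h2 with rfl | h2
      · exact absurd h1 has
      · exact ⟨h1, h2⟩
  rw [this]
  exact inter_mem_pairInfs hs𝒮 ht𝒮 hne

/-- Intersections containing `a`: `pairInfs slice₁` lifts into `pairInfs 𝒮`. [this work] -/
theorem image_insert_pairInfs_slice₁_subset : (pairInfs (slice₁ a 𝒮)).image (insert a) ⊆ pairInfs 𝒮 := by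
  intro x hx
  obtain ⟨y, hy, rfl⟩ := mem_image.1 hx
  obtain ⟨p, hp, rfl⟩ := mem_image.1 hy
  obtain ⟨h1, h2, h3⟩ := mem_offDiag.1 hp
  obtain ⟨h1𝒮, ha1⟩ := mem_slice₁.1 h1
  obtain ⟨h2𝒮, ha2⟩ := mem_slice₁.1 h2
  have hne : insert a p.1 ≠ insert a p.2 := fun h => h3 (by
    have := congrArg (fun s => s.erase a) h
    simpa only [erase_insert ha1, erase_insert ha2] using this)
  rw [show insert a (p.1 ∩ p.2) = insert a p.1 ∩ insert a p.2 from insert_inter_distrib p.1 p.2 a]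
  exact inter_mem_pairInfs h1𝒮 h2𝒮 hne

/-- Lower bound for the weight of `pairSups 𝒮` from the slices. [this work] -/
theorem sum_pairSups_ge (hu : a ∉ u) (h𝒮 : 𝒮 ⊆ (insert a u).powerset) {w : Finset α → ℝ} (hw : ∀ s, 0 ≤ w s) :
    ∑ s ∈ pairSups (slice₀ a 𝒮), w s + ∑ s ∈ (slice₀ a 𝒮 ⊻ slice₁ a 𝒮) ∪ pairSups (slice₁ a 𝒮), w (insert a s)
      ≤ ∑ s ∈ pairSups 𝒮, w s := by
  set P₀ := pairSups (slice₀ a 𝒮)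
  set P₁ := (slice₀ a 𝒮 ⊻ slice₁ a 𝒮) ∪ pairSups (slice₁ a 𝒮)
  -- members of P₁ avoid a
  have hP₁a : ∀ s ∈ P₁, a ∉ s := by
    intro s hs
    rcases mem_union.1 hs with hs | hs
    · obtain ⟨x, hx, y, hy, rfl⟩ := mem_sups.1 hs
      rw [sup_eq_union, mem_union, not_or]
      exact ⟨(mem_slice₀.1 hx).2, (mem_slice₁.1 hy).2⟩
    · have := subset_of_mem_pairSups (slice₁_subset h𝒮) hs
      exact fun h => hu (this h)
  have hP₀a : ∀ s ∈ P₀, a ∉ s := by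
    intro s hs
    have := subset_of_mem_pairSups (slice₀_subset h𝒮) hs
    exact fun h => hu (this h)
  have hinj : Set.InjOn (fun s : Finset α => insert a s) (P₁ : Set (Finset α)) := by
    intro s hs t ht hst
    have := congrArg (fun x => x.erase a) hst
    simpa only [erase_insert (hP₁a s hs), erase_insert (hP₁a t ht)] using this
  have hdisj : Disjoint P₀ (P₁.image (insert a)) := by
    rw [disjoint_left]
    intro s hs hs'
    obtain ⟨t, -, rfl⟩ := mem_image.1 hs'
    exact hP₀a _ hs (mem_insert_self a t)
  have hsub : P₀ ∪ P₁.image (insert a) ⊆ pairSups 𝒮 :=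
    union_subset (pairSups_mono (filter_subset _ _)) image_insert_subset_pairSups
  calc ∑ s ∈ P₀, w s + ∑ s ∈ P₁, w (insert a s)
      = ∑ s ∈ P₀, w s + ∑ s ∈ P₁.image (insert a), w s := by rw [sum_image hinj]
    _ = ∑ s ∈ P₀ ∪ P₁.image (insert a), w s := (sum_union hdisj).symm
    _ ≤ ∑ s ∈ pairSups 𝒮, w s := sum_le_sum_of_subset_of_nonneg hsub fun s _ _ => hw s

/-- Lower bound for the weight of `pairInfs 𝒮` from the slices. [this work] -/
theorem sum_pairInfs_ge (hu : a ∉ u) (h𝒮 : 𝒮 ⊆ (insert a u).powerset) {w : Finset α → ℝ} (hw : ∀ s, 0 ≤ w s) :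
    ∑ s ∈ (slice₀ a 𝒮 ⊼ slice₁ a 𝒮) ∪ pairInfs (slice₀ a 𝒮), w s + ∑ s ∈ pairInfs (slice₁ a 𝒮), w (insert a s)
      ≤ ∑ s ∈ pairInfs 𝒮, w s := by
  set P₀ := (slice₀ a 𝒮 ⊼ slice₁ a 𝒮) ∪ pairInfs (slice₀ a 𝒮)
  set P₁ := pairInfs (slice₁ a 𝒮)
  have hP₁a : ∀ s ∈ P₁, a ∉ s := by
    intro s hs
    have := subset_of_mem_pairInfs (slice₁_subset h𝒮) hs
    exact fun h => hu (this h)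
  have hP₀a : ∀ s ∈ P₀, a ∉ s := by
    intro s hs
    rcases mem_union.1 hs with hs | hs
    · obtain ⟨x, hx, y, _, rfl⟩ := mem_infs.1 hs
      rw [inf_eq_inter, mem_inter, not_and]
      exact fun h => absurd h (mem_slice₀.1 hx).2
    · have := subset_of_mem_pairInfs (slice₀_subset h𝒮) hs
      exact fun h => hu (this h)
  have hinj : Set.InjOn (fun s : Finset α => insert a s) (P₁ : Set (Finset α)) := by
    intro s hs t ht hst
    have := congrArg (fun x => x.erase a) hst
    simpa only [erase_insert (hP₁a s hs), erase_insert (hP₁a t ht)] using this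
  have hdisj : Disjoint P₀ (P₁.image (insert a)) := by
    rw [disjoint_left]
    intro s hs hs'
    obtain ⟨t, -, rfl⟩ := mem_image.1 hs'
    exact hP₀a _ hs (mem_insert_self a t)
  have hsub : P₀ ∪ P₁.image (insert a) ⊆ pairInfs 𝒮 :=
    union_subset (union_subset infs_slice_subset_pairInfs (pairInfs_mono (filter_subset _ _)))
      image_insert_pairInfs_slice₁_subset
  calc ∑ s ∈ P₀, w s + ∑ s ∈ P₁, w (insert a s)
      = ∑ s ∈ P₀, w s + ∑ s ∈ P₁.image (insert a), w s := by rw [sum_image hinj]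
    _ = ∑ s ∈ P₀ ∪ P₁.image (insert a), w s := (sum_union hdisj).symm
    _ ≤ ∑ s ∈ pairInfs 𝒮, w s := sum_le_sum_of_subset_of_nonneg hsub fun s _ _ => hw s

end Lifts

/-! ### 4. The distinct-pairs Ahlswede–Daykin inequality -/

/-- **Distinct-pairs Ahlswede–Daykin (weighted; log-supermodular weight on `2^u`).**
`(Σ_𝒮 w)² ≤ Σ_𝒮 w² + 2 (Σ_{pairInfs 𝒮} w)(Σ_{pairSups 𝒮} w)`, i.e. `Σ_{s ≠ t ∈ 𝒮} w(s)w(t) ≤ 2·w(pairInfs 𝒮)·w(pairSups 𝒮)`.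
Proof by induction on the ground set: slice by the last point, the slices are the induction hypothesis, the cross term is the
four functions theorem for `(w, w(a ∪ ·), w, w(a ∪ ·))` on `2^u`, and every cross pair is a pair of distinct members. [this work] -/
theorem sq_sum_le_of_logSupermodular (u : Finset α) :
    ∀ (𝒮 : Finset (Finset α)) (w : Finset α → ℝ), (∀ s, 0 ≤ w s) →
      (∀ s ⊆ u, ∀ t ⊆ u, w s * w t ≤ w (s ∩ t) * w (s ∪ t)) → 𝒮 ⊆ u.powerset →
      (∑ s ∈ 𝒮, w s) ^ 2 ≤ ∑ s ∈ 𝒮, w s ^ 2 + 2 * ((∑ s ∈ pairInfs 𝒮, w s) * ∑ s ∈ pairSups 𝒮, w s) := by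
  induction u using Finset.induction with
  | empty =>
    intro 𝒮 w hw _ h𝒮
    have hnn : 0 ≤ (∑ s ∈ pairInfs 𝒮, w s) * ∑ s ∈ pairSups 𝒮, w s :=
      mul_nonneg (sum_nonneg fun s _ => hw s) (sum_nonneg fun s _ => hw s)
    rw [powerset_empty] at h𝒮
    rcases subset_singleton_iff.1 h𝒮 with rfl | rfl
    · simp only [sum_empty]; nlinarith
    · simp only [sum_singleton]; nlinarith
  | insert a u hu ih =>
    intro 𝒮 w hw hmod h𝒮
    -- slices and their weights
    set T₀ := slice₀ a 𝒮 with hT₀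
    set T₁ := slice₁ a 𝒮 with hT₁
    set w₁ : Finset α → ℝ := fun s => w (insert a s) with hw₁
    have hw₁nn : ∀ s, 0 ≤ w₁ s := fun s => hw _
    have hT₀u : T₀ ⊆ u.powerset := slice₀_subset h𝒮
    have hT₁u : T₁ ⊆ u.powerset := slice₁_subset h𝒮
    -- log-supermodularity on 2^u for w and for w₁, and the mixed condition
    have hsub : ∀ s ⊆ u, s ⊆ insert a u := fun s hs => hs.trans (subset_insert a u)
    have hins : ∀ s ⊆ u, insert a s ⊆ insert a u := fun s hs => insert_subset_insert a hs
    have hmod₀ : ∀ s ⊆ u, ∀ t ⊆ u, w s * w t ≤ w (s ∩ t) * w (s ∪ t) :=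
      fun s hs t ht => hmod s (hsub s hs) t (hsub t ht)
    have hmod₁ : ∀ s ⊆ u, ∀ t ⊆ u, w₁ s * w₁ t ≤ w₁ (s ∩ t) * w₁ (s ∪ t) := by
      intro s hs t ht
      have := hmod (insert a s) (hins s hs) (insert a t) (hins t ht)
      simp only [hw₁]
      rwa [← insert_inter_distrib, ← insert_union_distrib] at this
    have hmodx : ∀ s ⊆ u, ∀ t ⊆ u, w s * w₁ t ≤ w (s ∩ t) * w₁ (s ∪ t) := by
      intro s hs t ht
      have has : a ∉ s := fun h => hu (hs h)
      have := hmod s (hsub s hs) (insert a t) (hins t ht)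
      have e1 : s ∩ insert a t = s ∩ t := by
        ext x; simp only [mem_inter, mem_insert]
        constructor
        · rintro ⟨h1, h2⟩
          rcases h2 with rfl | h2
          · exact absurd h1 has
          · exact ⟨h1, h2⟩
        · rintro ⟨h1, h2⟩; exact ⟨h1, Or.inr h2⟩
      have e2 : s ∪ insert a t = insert a (s ∪ t) := by
        ext x; simp only [mem_union, mem_insert]; tauto
      simp only [hw₁]
      rwa [e1, e2] at this
    -- induction hypotheses on the two slices
    have ih₀ := ih T₀ w hw hmod₀ hT₀u
    have ih₁ := ih T₁ w₁ hw₁nn hmod₁ hT₁u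
    -- the cross term: four functions theorem
    have hx : (∑ s ∈ T₀, w s) * ∑ s ∈ T₁, w₁ s ≤ (∑ s ∈ T₀ ⊼ T₁, w s) * ∑ s ∈ T₀ ⊻ T₁, w₁ s :=
      Finset.four_functions_theorem u (fun s => hw s) (fun s => hw₁nn s) (fun s => hw s) (fun s => hw₁nn s)
        (fun s hs t ht => hmodx s hs t ht) hT₀u hT₁u
    -- the decompositions of the three sums over 𝒮
    have hS : ∑ s ∈ 𝒮, w s = ∑ s ∈ T₀, w s + ∑ s ∈ T₁, w₁ s := sum_eq_sum_slice₀_add_sum_slice₁ w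
    have hQ : ∑ s ∈ 𝒮, w s ^ 2 = ∑ s ∈ T₀, w s ^ 2 + ∑ s ∈ T₁, w₁ s ^ 2 :=
      sum_eq_sum_slice₀_add_sum_slice₁ (fun s => w s ^ 2)
    have hU := sum_pairSups_ge hu h𝒮 hw
    have hI := sum_pairInfs_ge hu h𝒮 hw
    -- monotonicity facts for the partial sums
    have hU₁ : ∑ s ∈ pairSups T₁, w₁ s ≤ ∑ s ∈ (T₀ ⊻ T₁) ∪ pairSups T₁, w (insert a s) :=
      sum_le_sum_of_subset_of_nonneg subset_union_right fun s _ _ => hw _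
    have hXU : ∑ s ∈ T₀ ⊻ T₁, w₁ s ≤ ∑ s ∈ (T₀ ⊻ T₁) ∪ pairSups T₁, w (insert a s) :=
      sum_le_sum_of_subset_of_nonneg subset_union_left fun s _ _ => hw _
    have hI₀ : ∑ s ∈ pairInfs T₀, w s ≤ ∑ s ∈ (T₀ ⊼ T₁) ∪ pairInfs T₀, w s :=
      sum_le_sum_of_subset_of_nonneg subset_union_right fun s _ _ => hw _
    have hXI : ∑ s ∈ T₀ ⊼ T₁, w s ≤ ∑ s ∈ (T₀ ⊼ T₁) ∪ pairInfs T₀, w s :=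
      sum_le_sum_of_subset_of_nonneg subset_union_left fun s _ _ => hw _
    -- nonnegativity of everything in sight
    have n4 : 0 ≤ ∑ s ∈ pairSups T₀, w s := sum_nonneg fun s _ => hw s
    have n5 : 0 ≤ ∑ s ∈ pairInfs T₁, w₁ s := sum_nonneg fun s _ => hw₁nn s
    have n8 : 0 ≤ ∑ s ∈ T₀ ⊻ T₁, w₁ s := sum_nonneg fun s _ => hw₁nn s
    have n10 : 0 ≤ ∑ s ∈ (T₀ ⊼ T₁) ∪ pairInfs T₀, w s := sum_nonneg fun s _ => hw _
    have n11 : 0 ≤ ∑ s ∈ pairInfs 𝒮, w s := sum_nonneg fun s _ => hw s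
    -- assemble
    have hpi : ∑ s ∈ pairInfs T₁, w (insert a s) = ∑ s ∈ pairInfs T₁, w₁ s := rfl
    rw [hpi] at hI
    set S₀ := ∑ s ∈ T₀, w s
    set S₁ := ∑ s ∈ T₁, w₁ s
    set I₀ := ∑ s ∈ pairInfs T₀, w s
    set U₀ := ∑ s ∈ pairSups T₀, w s
    set I₁ := ∑ s ∈ pairInfs T₁, w₁ s
    set U₁ := ∑ s ∈ pairSups T₁, w₁ s
    set XI := ∑ s ∈ T₀ ⊼ T₁, w s
    set XU := ∑ s ∈ T₀ ⊻ T₁, w₁ s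
    set U₁' := ∑ s ∈ (T₀ ⊻ T₁) ∪ pairSups T₁, w (insert a s)
    set I₀' := ∑ s ∈ (T₀ ⊼ T₁) ∪ pairInfs T₀, w s
    set I := ∑ s ∈ pairInfs 𝒮, w s
    set U := ∑ s ∈ pairSups 𝒮, w s
    have key : I₀ * U₀ + I₁ * U₁ + XI * XU ≤ I * U := by
      have h1 : I₀ * U₀ ≤ I₀' * U₀ := mul_le_mul_of_nonneg_right hI₀ n4
      have h2 : I₁ * U₁ ≤ I₁ * U₁' := mul_le_mul_of_nonneg_left hU₁ n5
      have h3 : XI * XU ≤ I₀' * U₁' := mul_le_mul hXI hXU n8 n10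
      have h4 : I₀' * U₀ + I₁ * U₁' + I₀' * U₁' ≤ (I₁ + I₀') * (U₀ + U₁') := by nlinarith
      have h5 : (I₁ + I₀') * (U₀ + U₁') ≤ I * U := by
        have : I₁ + I₀' ≤ I := by linarith
        have : U₀ + U₁' ≤ U := by linarith
        exact mul_le_mul ‹I₁ + I₀' ≤ I› ‹U₀ + U₁' ≤ U› (by linarith) n11
      linarith
    rw [hS, hQ]
    nlinarith [ih₀, ih₁, hx, key]

/-- **Counting form: `m(m−1) ≤ 2·|pairInfs|·|pairSups|` for every family of `m` distinct finite sets**, i.e.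
`C(m,2) ≤ |{s ∩ t : s ≠ t}| · |{s ∪ t : s ≠ t}|`; tight for the facets of a simplex. [this work] -/
theorem card_choose_two_le (𝒮 : Finset (Finset α)) : #𝒮 * (#𝒮 - 1) ≤ 2 * (#(pairInfs 𝒮) * #(pairSups 𝒮)) := by
  have h := sq_sum_le_of_logSupermodular (𝒮.sup id) 𝒮 (fun _ => (1 : ℝ)) (fun _ => zero_le_one)
    (fun _ _ _ _ => by norm_num) fun s hs => mem_powerset.2 (le_sup (f := id) hs)
  simp only [sum_const, nsmul_eq_mul, mul_one, one_pow] at h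
  rcases Nat.eq_zero_or_pos #𝒮 with h0 | hpos
  · rw [h0]; simp
  · have : ((#𝒮 * (#𝒮 - 1) : ℕ) : ℝ) ≤ ((2 * (#(pairInfs 𝒮) * #(pairSups 𝒮)) : ℕ) : ℝ) := by
      push_cast
      rw [Nat.cast_sub hpos, Nat.cast_one]
      nlinarith [h]
    exact_mod_cast this

end Summit.CriticalPhenomena.PercolationContinuityZ3.Theorems.SahiStrongDaykin
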